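import Literature.NumberTheory.LFunctions.AlmostMonomialLowDegree
import Literature.RepresentationTheory.FiniteGroups.PermutationCharacter
import Literature.RepresentationTheory.FiniteGroups.AlternatingFiveCharacterDegrees
import HarnessLib

/-!
# `A₅` is almost monomial (Booker 2006, Proposition 2.3, second group) — proved

Topic `Literature/NumberTheory/LFunctions`; companion of `CertifiedArtinHolomorphyCriterion.lean`
(Booker's Definition 2.1 `Booker2006.IsAlmostMonomial`, the NAMED FACT `booker2006_proposition23`)
and of `AlmostMonomialLowDegree.lean` (the engine: DM-positive virtual characters have natural
degrees, degree-`≤ 3` irreducibles never split, the degree criterion).  Kernel lane: a few small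
`decide` computations over the `60` elements of `A₅`; no named fact; standard axioms.

Source: A. R. Booker, *Artin's conjecture, Turing's method, and the Riemann hypothesis*,
Experiment. Math. **15** (2006) 385–407, §2 **Proposition 2.3** (p. 390): "The groups `SL₂(𝔽₃)`,
`A₅`, and `S₅` are almost monomial" — "shown with the aid of the computer algebra system GAP"
(enumerate the monomial characters, solve the integral system (2–7)).

## The proof formalised here (replacing the GAP computation)

Write `G = A₅ ≤ S₅` (Mathlib `alternatingGroup (Fin 5)`), `c = (0 1 2 3 4)`,
`D = N_G(⟨c⟩) ≅ D₁₀` (the ten `g` with `gcg⁻¹ ∈ {c, c², c³, c⁴}`), `ε : D → {±1}` the sign character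
of `D₁₀` (`+1` on the rotations, `−1` on the reflections), and consider the three MONOMIAL characters

* `M₁ = Ind_{G_0}^G 1 = π₅ = #fix` (the permutation character on `5` points; `G_0 ≅ A₄`),
* `M₂ = Ind_D^G 1` (the permutation character on the `6` Sylow `5`-subgroups),
* `M₃ = Ind_D^G ε`,

whose values (class functions; classes `1`, `(2,2)`, `3`, `5`, `5'`) are
`M₁ = (5,1,2,0,0)`, `M₂ = (6,2,0,1,1)`, `M₃ = (6,−2,0,1,1)` — certified here by the kernel from the
defining sums `Ind_H^G θ (s) = |H|⁻¹ Σ_t θ̇(t⁻¹ s t)` (`S2_eq_T2`, `S3_eq_T3`; `decide`).  Then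
`χ₄ := M₁ − 1` (the tree's `isIrrChar_alternatingGroup_natCard_fixedBy_sub_one`) and
`χ₅ := M₂ − 1` (`⟨M₂, 1⟩ = 1`, `⟨M₂, M₂⟩ = 2`) are irreducible of degrees `4`, `5`; by the tree's
degree census `JamesLiebeck2001_ex2014_degrees` (`A₅` has degrees `1, 3, 3, 4, 5`) every irreducible
`ρ` of `A₅` has degree `≤ 3` or is `χ₄` or `χ₅`.  Degree `≤ 3`: the engine
(`eq_zero_or_eq_zero_of_split_of_apply_one_le_three`).  For `ρ ∈ {χ₄, χ₅}` and a splitting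
`ρ = χ₁ + χ₂` into DM-positive virtual characters put `nᵢ = ⟨χ₁, Mᵢ⟩ ∈ ℕ`, `a = ⟨χ₁, 1⟩`; Definition
2.1 gives `nᵢ ≤ ⟨ρ, Mᵢ⟩`, `a = 0`, and the class-function identity
`Ind_1^G 1 = 4M₁ + 5M₂ + 3M₃ − 8·1` (checked pointwise by the kernel) gives
`χ₁(1) = ⟨χ₁, Ind_1^G 1⟩ = 4n₁ + 5n₂ + 3n₃ − 8a`.  With the scalar products
`⟨χ₄, M₁⟩ = 1, ⟨χ₄, M₂⟩ = ⟨χ₄, M₃⟩ = 0` resp. `⟨χ₅, M₁⟩ = ⟨χ₅, M₃⟩ = 0, ⟨χ₅, M₂⟩ = 1` (kernel) this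
forces `χ₁(1) ∈ {0, ρ(1)}`, and the degree criterion (`eq_zero_or_eq_zero_of_split_of_apply_one`)
ends the proof.  (In representation-theoretic terms: `M₃ = ψ₃ + ψ₃'` detects the two degree-`3`
characters, which no permutation character separates from `χ₅`; this is the one place where a
non-trivial `θ` is needed.)

Main results: `Booker2006.A5.isIrrChar_chi5` (the degree-`5` character `Ind_D 1 − 1`),
**`Booker2006.isAlmostMonomial_alternatingGroup_five : IsAlmostMonomial (alternatingGroup (Fin 5))`**.

## References

* [Booker2006] A. R. Booker, Experiment. Math. 15 (2006) 385–407, §2 Definition 2.1 (p. 389),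
  Proposition 2.3 (p. 390) (journal pdf `paper:url-702ab4eacdaa`; arXiv:math/0507502 Prop. 3).
* [JamesLiebeck2001] G. James, M. Liebeck, *Representations and Characters of Groups*, 2nd ed.,
  CUP 2001, Example 20.14 (the character table of `A₅`), 29.11 (1).
* [Isaacs1976] I. M. Isaacs, *Character Theory of Finite Groups*, Lemma 5.14 (`(1_H)^G`).
-/

noncomputable section

open scoped ComplexOrder
open Finset MulAction

namespace Literature.NumberTheory.LFunctions

namespace Booker2006

open Literature.RepresentationTheory.FiniteGroups

/-! ### General helpers (any finite group) -/

section General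

variable {G : Type} [Group G] [Fintype G]

/-- Right additivity of the scalar product. [folklore] -/
private theorem classInner_add_right (φ ψ ψ' : G → ℂ) :
    classInner φ (ψ + ψ') = classInner φ ψ + classInner φ ψ' := by
  rw [classInner_comm, classInner_add_left, classInner_comm ψ, classInner_comm ψ']

/-- Right homogeneity of the scalar product. [folklore] -/
private theorem classInner_smul_right (c : ℂ) (φ ψ : G → ℂ) :
    classInner φ (c • ψ) = c * classInner φ ψ := by
  rw [classInner_comm, classInner_smul_left, classInner_comm]

/-- Right subtraction for the scalar product. [folklore] -/
private theorem classInner_sub_right (φ ψ ψ' : G → ℂ) :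
    classInner φ (ψ - ψ') = classInner φ ψ - classInner φ ψ' := by
  rw [sub_eq_add_neg, classInner_add_right, ← neg_one_smul ℂ ψ', classInner_smul_right]
  ring

/-- `⟨χ, Ind_1^G 1⟩ = χ(1)` for a class function `χ` (the regular character is monomial).
[cite: Booker2006, §2 (2–4) p. 389] -/
private theorem classInner_indClassFun_bot (χ : G → ℂ) (hχ : IsClassFun χ) :
    classInner χ (indClassFun (⊥ : Subgroup G) fun h => ((1 : (⊥ : Subgroup G) →* ℂˣ) h : ℂ)) =
      χ 1 := by
  rw [classInner_indClassFun_right ⊥ _ hχ, classInner_apply, Fintype.card_unique,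
    Fintype.sum_unique]
  have hd : (default : (⊥ : Subgroup G)) = 1 := Subsingleton.elim _ _
  rw [hd]
  simp

/-- The regular character `Ind_1^G 1`: value `|G|` at `1` and `0` elsewhere. [folklore] -/
private theorem indClassFun_bot_apply [DecidableEq G] (s : G) :
    indClassFun (⊥ : Subgroup G) (fun h => ((1 : (⊥ : Subgroup G) →* ℂˣ) h : ℂ)) s =
      if s = 1 then (Fintype.card G : ℂ) else 0 := by
  classical
  rw [indClassFun_apply]
  have hext : ∀ t : G, Function.extend (Subtype.val : (⊥ : Subgroup G) → G)
      (fun h => ((1 : (⊥ : Subgroup G) →* ℂˣ) h : ℂ)) 0 (t⁻¹ * s * t) = if s = 1 then 1 else 0 := by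
    intro t
    by_cases hs : s = 1
    · subst hs
      have hmem : t⁻¹ * 1 * t ∈ (⊥ : Subgroup G) := by simp
      rw [show t⁻¹ * 1 * t = ((⟨t⁻¹ * 1 * t, hmem⟩ : (⊥ : Subgroup G)) : G) from rfl,
        extend_subtypeVal_apply]
      simp
    · have hnmem : t⁻¹ * s * t ∉ (⊥ : Subgroup G) := by
        rw [Subgroup.mem_bot]
        intro h
        apply hs
        have : s = t * (t⁻¹ * s * t) * t⁻¹ := by group
        rw [this, h]; group
      rw [extend_subtypeVal_of_not_mem _ _ hnmem, if_neg hs]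
  simp only [hext, Finset.sum_const, Finset.card_univ, nsmul_eq_mul, Subgroup.card_bot,
    Nat.cast_one, inv_one, one_mul]
  split_ifs <;> simp

omit [Fintype G] in
/-- `1_G` is irreducible. [folklore] -/
private theorem isIrrChar_one' : IsIrrChar G (1 : G → ℂ) := by
  have h := character_trivial_mem_irrChars (G := G)
  have h1 : (Representation.trivial ℂ G ℂ).character = 1 := by
    funext x; simp [Representation.character]
  rwa [h1] at h

/-- A non-empty multiset of irreducible characters sums to a character. [folklore] -/
private theorem isCharacter_multiset_sum' :
    ∀ m : Multiset (G → ℂ), (∀ χ ∈ m, IsIrrChar G χ) → m ≠ 0 → IsCharacter G m.sum := by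
  intro m
  induction m using Multiset.induction_on with
  | empty => intro _ h; exact absurd rfl h
  | cons χ m ih =>
    intro hm _
    by_cases h0 : m = 0
    · subst h0
      simpa using (hm χ (Multiset.mem_cons_self _ _)).isCharacter
    · rw [Multiset.sum_cons]
      exact IsCharacter.add (hm χ (Multiset.mem_cons_self _ _)).isCharacter
        (ih (fun χ' h' => hm χ' (Multiset.mem_cons_of_mem h')) h0)

/-- **J–L 29.10 in scalar-product form:** a character `π` with `⟨π, 1⟩ = 1` and `⟨π, π⟩ = 2` is
`1 + ψ` with `ψ` irreducible, `ψ ≠ 1`. [cite: JamesLiebeck2001, Cor. 29.10] -/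
theorem exists_isIrrChar_eq_one_add_of_classInner {π : G → ℂ} (hπ : IsCharacter G π)
    (hπ1 : classInner π 1 = 1) (hππ : classInner π π = 2) :
    ∃ ψ : G → ℂ, IsIrrChar G ψ ∧ ψ ≠ 1 ∧ π = 1 + ψ := by
  classical
  obtain ⟨m, hm, hsum⟩ := hπ.exists_multiset_irrChars
  have h11 : classInner (1 : G → ℂ) 1 = 1 := by
    rw [isIrrChar_one'.classInner_eq isIrrChar_one', if_pos rfl]
  have hcount : m.count 1 = 1 := by
    have h := classInner_multiset_sum_irrChars hm isIrrChar_one'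
    rw [← hsum, hπ1] at h
    exact_mod_cast h.symm
  obtain ⟨m', rfl⟩ : ∃ m', m = (1 : G → ℂ) ::ₘ m' :=
    Multiset.exists_cons_of_mem (Multiset.count_pos.mp (by omega))
  have hm' : ∀ χ ∈ m', IsIrrChar G χ := fun χ h => hm χ (Multiset.mem_cons_of_mem h)
  have hcount' : m'.count 1 = 0 := by
    rw [Multiset.count_cons_self] at hcount
    omega
  have hψ1 : classInner m'.sum 1 = 0 := by
    rw [classInner_multiset_sum_irrChars hm' isIrrChar_one', hcount', Nat.cast_zero]
  have heq : π = 1 + m'.sum := by rw [hsum, Multiset.sum_cons]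
  have hψψ : classInner m'.sum m'.sum = 1 := by
    rw [heq, classInner_add_left, classInner_comm (1 : G → ℂ) (1 + m'.sum),
      classInner_comm m'.sum (1 + m'.sum), classInner_add_left, classInner_add_left, h11, hψ1,
      classInner_comm (1 : G → ℂ) m'.sum, hψ1] at hππ
    linear_combination hππ
  have hm'0 : m' ≠ 0 := by
    rintro rfl
    rw [Multiset.sum_zero, classInner_zero_left] at hψψ
    exact zero_ne_one hψψ
  refine ⟨m'.sum, (isCharacter_multiset_sum' m' hm' hm'0).isIrrChar_of_classInner_eq_one hψψ, ?_, heq⟩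
  intro h1
  rw [h1, h11] at hψ1
  exact one_ne_zero hψ1

omit [Fintype G] in
/-- Two irreducible characters of the same degree `d` coincide when `G` has exactly one
irreducible character of degree `d`. [folklore] -/
private theorem eq_of_natCard_degree_eq_one {d : ℕ}
    (h : Nat.card {χ : G → ℂ // IsIrrChar G χ ∧ χ 1 = ((d : ℕ) : ℂ)} = 1) {ρ ψ : G → ℂ}
    (hρ : IsIrrChar G ρ) (hρd : ρ 1 = d) (hψ : IsIrrChar G ψ) (hψd : ψ 1 = d) : ρ = ψ := by
  have hs := (Nat.card_eq_one_iff_unique.mp h).1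
  have := hs.elim ⟨ρ, hρ, hρd⟩ ⟨ψ, hψ, hψd⟩
  exact congrArg Subtype.val this

end General

/-! ### The group `A₅` and its computable class functions -/

/-- `A₅` as a type. [cite: Booker2006, §2 Proposition 2.3 p. 390] -/
abbrev Alt5 : Type := ↥(alternatingGroup (Fin 5))

namespace A5

/-- The `5`-cycle `(0 1 2 3 4)` is even. [folklore] -/
private theorem finRotate_mem : finRotate 5 ∈ alternatingGroup (Fin 5) := by
  rw [Equiv.Perm.mem_alternatingGroup]; decide

/-- The `5`-cycle `c = (0 1 2 3 4) ∈ A₅`. [cite: Booker2006, §2 Proposition 2.3 p. 390] -/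
def c : Alt5 := ⟨finRotate 5, finRotate_mem⟩

/-- Membership test for `D = N_{A₅}(⟨c⟩) ≅ D₁₀`: `gcg⁻¹ ∈ {c, c², c³, c⁴}`.
[cite: Booker2006, §2 Proposition 2.3 p. 390] -/
def inD (g : Alt5) : Bool :=
  decide (g * c * g⁻¹ = c) || decide (g * c * g⁻¹ = c ^ 2) || decide (g * c * g⁻¹ = c ^ 3) ||
    decide (g * c * g⁻¹ = c ^ 4)

/-- The sign character of `D₁₀` extended to `A₅`: `+1` on the elements commuting with `c` (the
rotations), `−1` elsewhere (on `D`: the reflections). [cite: Booker2006, §2 Proposition 2.3 p. 390] -/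
def epsU (g : Alt5) : ℤˣ := if g * c = c * g then 1 else -1

/-- `S₂(s) = #{t ∈ A₅ : t⁻¹ s t ∈ D} = |D| · (Ind_D 1)(s)`. [cite: Isaacs1976, Lemma 5.14] -/
def S2 (s : Alt5) : ℕ := (Finset.univ.filter fun t : Alt5 => inD (t⁻¹ * s * t) = true).card

/-- `S₃(s) = Σ_{t : t⁻¹ s t ∈ D} ε(t⁻¹ s t) = |D| · (Ind_D ε)(s)`. [cite: Isaacs1976, Lemma 5.14] -/
def S3 (s : Alt5) : ℤ := ∑ t : Alt5, if inD (t⁻¹ * s * t) = true then ((epsU (t⁻¹ * s * t) : ℤˣ) : ℤ) else 0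

/-- The values of `S₂` by element order (`1`; involutions; `3`-cycles; `5`-cycles): `60, 20, 0, 10`.
[cite: JamesLiebeck2001, Example 20.14] -/
def T2 (g : Alt5) : ℕ := if g = 1 then 60 else if g * g = 1 then 20 else if g * g * g = 1 then 0 else 10

/-- The values of `S₃` by element order: `60, −20, 0, 10`. [cite: JamesLiebeck2001, Example 20.14] -/
def T3 (g : Alt5) : ℤ := if g = 1 then 60 else if g * g = 1 then -20 else if g * g * g = 1 then 0 else 10

/-- The number of fixed points of `g ∈ A₅` on `{0, …, 4}`. [cite: JamesLiebeck2001, Ex. 29.11 (1)] -/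
def fixN (g : Alt5) : ℕ := (Finset.univ.filter fun i : Fin 5 => g • i = i).card

/-! #### Kernel computations -/

/-- `1 ∈ D`. [folklore] -/
private theorem inD_one : inD 1 = true := by decide

/-- `D` is closed under multiplication. [folklore] -/
private theorem inD_mul : ∀ a b : Alt5, inD a = true → inD b = true → inD (a * b) = true := by
  decide +kernel

/-- `D` is closed under inversion. [folklore] -/
private theorem inD_inv : ∀ a : Alt5, inD a = true → inD a⁻¹ = true := by decide +kernel

/-- `|D| = 10`. [folklore] -/
private theorem card_filter_inD : (Finset.univ.filter fun g : Alt5 => inD g = true).card = 10 := by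
  decide +kernel

/-- `ε(1) = 1`. [folklore] -/
private theorem epsU_one : epsU 1 = 1 := by decide

/-- `ε` is multiplicative on `D`. [folklore] -/
private theorem epsU_mul : ∀ a b : Alt5, inD a = true → inD b = true →
    epsU (a * b) = epsU a * epsU b := by
  decide +kernel

/-- **The table of `Ind_D 1`** (times `|D| = 10`). [cite: JamesLiebeck2001, Example 20.14] -/
theorem S2_eq_T2 : ∀ g : Alt5, S2 g = T2 g := by decide +kernel

/-- **The table of `Ind_D ε`** (times `|D| = 10`). [cite: JamesLiebeck2001, Example 20.14] -/
theorem S3_eq_T3 : ∀ g : Alt5, S3 g = T3 g := by decide +kernel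

/-- `|A₅| = 60`. [folklore] -/
private theorem card_G : Fintype.card Alt5 = 60 := by
  rw [← Nat.card_eq_fintype_card]
  exact Literature.NumberTheory.GaloisRepresentations.Serre1972.natCard_alternatingGroup_fin_five

/-- The class-function identity `Ind_1^Alt5 1 = 4M₁ + 5M₂ + 3M₃ − 8` (times `10`), pointwise.
[cite: JamesLiebeck2001, Example 20.14] -/
private theorem reg_identity : ∀ g : Alt5,
    (if g = 1 then (600 : ℤ) else 0) = 40 * (fixN g : ℤ) + 5 * (T2 g : ℤ) + 3 * T3 g - 80 := by
  decide +kernel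

/-- `Σ_g (fix g − 1)·fix g⁻¹ = 60` (`⟨χ₄, M₁⟩ = 1`). [cite: JamesLiebeck2001, Example 20.14] -/
private theorem sum_chi4_M1 : ∑ g : Alt5, ((fixN g : ℤ) - 1) * (fixN g⁻¹ : ℤ) = 60 := by
  decide +kernel

/-- `Σ_g (fix g − 1)·T₂ g⁻¹ = 0` (`⟨χ₄, M₂⟩ = 0`). [cite: JamesLiebeck2001, Example 20.14] -/
private theorem sum_chi4_M2 : ∑ g : Alt5, ((fixN g : ℤ) - 1) * (T2 g⁻¹ : ℤ) = 0 := by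
  decide +kernel

/-- `Σ_g (fix g − 1)·T₃ g⁻¹ = 0` (`⟨χ₄, M₃⟩ = 0`). [cite: JamesLiebeck2001, Example 20.14] -/
private theorem sum_chi4_M3 : ∑ g : Alt5, ((fixN g : ℤ) - 1) * T3 g⁻¹ = 0 := by
  decide +kernel

/-- `Σ_g (T₂ g − 10)·fix g⁻¹ = 0` (`⟨χ₅, M₁⟩ = 0`). [cite: JamesLiebeck2001, Example 20.14] -/
private theorem sum_chi5_M1 : ∑ g : Alt5, ((T2 g : ℤ) - 10) * (fixN g⁻¹ : ℤ) = 0 := by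
  decide +kernel

/-- `Σ_g (T₂ g − 10)·T₂ g⁻¹ = 6000` (`⟨χ₅, M₂⟩ = 1`). [cite: JamesLiebeck2001, Example 20.14] -/
private theorem sum_chi5_M2 : ∑ g : Alt5, ((T2 g : ℤ) - 10) * (T2 g⁻¹ : ℤ) = 6000 := by
  decide +kernel

/-- `Σ_g (T₂ g − 10)·T₃ g⁻¹ = 0` (`⟨χ₅, M₃⟩ = 0`). [cite: JamesLiebeck2001, Example 20.14] -/
private theorem sum_chi5_M3 : ∑ g : Alt5, ((T2 g : ℤ) - 10) * T3 g⁻¹ = 0 := by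
  decide +kernel

/-- `Σ_g T₂ g = 600` (`⟨M₂, 1⟩ = 1`). [cite: JamesLiebeck2001, Example 20.14] -/
private theorem sum_M2_one : ∑ g : Alt5, (T2 g : ℤ) = 600 := by
  decide +kernel

/-- `Σ_g T₂ g · T₂ g⁻¹ = 12000` (`⟨M₂, M₂⟩ = 2`). [cite: JamesLiebeck2001, Example 20.14] -/
private theorem sum_M2_M2 : ∑ g : Alt5, (T2 g : ℤ) * (T2 g⁻¹ : ℤ) = 12000 := by
  decide +kernel

/-! #### The subgroup `D ≅ D₁₀` and its sign character -/

/-- `D = N_{A₅}(⟨c⟩)`, a dihedral group of order `10` (a Sylow `5`-normaliser).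
[cite: Booker2006, §2 Proposition 2.3 p. 390] -/
def D : Subgroup Alt5 where
  carrier := {g | inD g = true}
  mul_mem' := fun {a} {b} ha hb => inD_mul a b ha hb
  one_mem' := inD_one
  inv_mem' := fun {a} ha => inD_inv a ha

/-- Membership in `D` is the Boolean test `inD`. [folklore] -/
private theorem mem_D_iff (g : Alt5) : g ∈ D ↔ inD g = true := Iff.rfl

/-- `|D| = 10`. [folklore] -/
private theorem natCard_D : Nat.card D = 10 := by
  have h : Nat.card D = Nat.card {g : Alt5 // inD g = true} := rfl
  rw [h, Nat.card_eq_fintype_card, Fintype.card_subtype]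
  exact card_filter_inD

/-- The sign character `ε : D → {±1} ⊂ ℤˣ`. [cite: Booker2006, §2 Proposition 2.3 p. 390] -/
def epsHom : D →* ℤˣ where
  toFun h := epsU h
  map_one' := epsU_one
  map_mul' := fun a b => epsU_mul a b a.2 b.2

/-- The sign character `ε` of `D` as a homomorphism `D → ℂˣ`.
[cite: Booker2006, §2 Proposition 2.3 p. 390] -/
def eps : D →* ℂˣ := (Units.map ((Int.castRingHom ℂ).toMonoidHom)).comp epsHom

/-- Values of `ε`: `((ε h : ℂˣ) : ℂ) = (epsU h : ℤ)`. [folklore] -/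
private theorem coe_eps (h : D) : ((eps h : ℂˣ) : ℂ) = (((epsU h : ℤˣ) : ℤ) : ℂ) := by
  simp [eps, epsHom]

/-! #### The three monomial characters as explicit functions -/

/-- `Ind_D^Alt5 θ` by the defining sum, with the Boolean membership test.
[cite: Isaacs1976, Lemma 5.14] -/
private theorem indClassFun_D_apply (θ : D →* ℂˣ) (f : Alt5 → ℂ) (hf : ∀ h : D, ((θ h : ℂˣ) : ℂ) = f h)
    (s : Alt5) :
    indClassFun D (fun h => ((θ h : ℂˣ) : ℂ)) s =
      (10 : ℂ)⁻¹ * ∑ t : Alt5, if inD (t⁻¹ * s * t) = true then f (t⁻¹ * s * t) else 0 := by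
  rw [indClassFun_apply, natCard_D, Nat.cast_ofNat]
  congr 1
  refine Finset.sum_congr rfl fun t _ => ?_
  by_cases h : inD (t⁻¹ * s * t) = true
  · have hmem : t⁻¹ * s * t ∈ D := h
    rw [show t⁻¹ * s * t = ((⟨t⁻¹ * s * t, hmem⟩ : D) : Alt5) from rfl, extend_subtypeVal_apply, hf,
      if_pos h]
  · have hnmem : t⁻¹ * s * t ∉ D := h
    rw [extend_subtypeVal_of_not_mem _ _ hnmem, if_neg h]

/-- **`M₂ = Ind_D^Alt5 1 = T₂/10`** as a function on `A₅`. [cite: JamesLiebeck2001, Example 20.14] -/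
theorem indClassFun_D_one_eq :
    indClassFun D (fun h => ((1 : D →* ℂˣ) h : ℂ)) = fun s => ((T2 s : ℕ) : ℂ) / 10 := by
  funext s
  rw [indClassFun_D_apply 1 (fun _ => 1) (fun h => by simp) s, Finset.sum_boole, ← S2_eq_T2 s]
  rw [div_eq_inv_mul]
  rfl

/-- **`M₃ = Ind_D^Alt5 ε = T₃/10`** as a function on `A₅`. [cite: JamesLiebeck2001, Example 20.14] -/
theorem indClassFun_D_eps_eq :
    indClassFun D (fun h => ((eps h : ℂˣ) : ℂ)) = fun s => ((T3 s : ℤ) : ℂ) / 10 := by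
  funext s
  rw [indClassFun_D_apply eps (fun g => (((epsU g : ℤˣ) : ℤ) : ℂ)) coe_eps s, ← S3_eq_T3 s, S3,
    Int.cast_sum, div_eq_inv_mul]
  congr 1
  refine Finset.sum_congr rfl fun t _ => ?_
  split_ifs <;> simp

/-- `#fix` as `Nat.card` of Mathlib's `fixedBy`. [folklore] -/
private theorem natCard_fixedBy_eq_fixN (g : Alt5) : Nat.card (fixedBy (Fin 5) g) = fixN g := by
  rw [fixN, ← Fintype.card_subtype]
  exact Nat.card_eq_fintype_card

/-- `A₅` is transitive on `{0, …, 4}`. [cite: JamesLiebeck2001, Ex. 29.11 (1)] -/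
private theorem isPretransitive_G : IsPretransitive Alt5 (Fin 5) := by
  haveI := alternatingGroup.isMultiplyPretransitive (Fin 5)
  have h5 : Nat.card (Fin 5) = 5 := by simp
  have h1 : IsMultiplyPretransitive Alt5 (Fin 5) 1 :=
    isMultiplyPretransitive_of_le (n := Nat.card (Fin 5) - 2) (by rw [h5]; norm_num) (by omega)
  exact is_one_pretransitive_iff.mp h1

/-- **`M₁ = Ind_{G_0}^Alt5 1 = #fix`** (Isaacs 5.14). [cite: Isaacs1976, Lemma 5.14] -/
theorem indClassFun_stabilizer_one_eq :
    indClassFun (stabilizer Alt5 (0 : Fin 5)) (fun h => ((1 : stabilizer Alt5 (0 : Fin 5) →* ℂˣ) h : ℂ)) =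
      fun s => ((fixN s : ℕ) : ℂ) := by
  haveI := isPretransitive_G
  have h1 : (fun h => ((1 : stabilizer Alt5 (0 : Fin 5) →* ℂˣ) h : ℂ)) =
      (1 : stabilizer Alt5 (0 : Fin 5) → ℂ) := by
    funext h; simp
  rw [h1, indClassFun_stabilizer_one (0 : Fin 5)]
  funext s
  rw [natCard_fixedBy_eq_fixN]

/-! #### The irreducible characters `χ₄`, `χ₅` -/

/-- `χ₄ = #fix − 1`. [cite: JamesLiebeck2001, Ex. 29.11 (1)] -/
def chi4 (g : Alt5) : ℂ := ((fixN g : ℕ) : ℂ) - 1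

/-- `χ₅ = Ind_D 1 − 1 = T₂/10 − 1`. [cite: JamesLiebeck2001, Example 20.14] -/
def chi5 (g : Alt5) : ℂ := ((T2 g : ℕ) : ℂ) / 10 - 1

/-- `χ₄` is an irreducible character of `A₅` (2-transitivity on `5` points).
[cite: JamesLiebeck2001, Ex. 29.11 (1)] -/
theorem isIrrChar_chi4 : IsIrrChar Alt5 chi4 := by
  have h := isIrrChar_alternatingGroup_natCard_fixedBy_sub_one (Ω := Fin 5) (by simp)
  have he : (fun σ : Alt5 => (Nat.card (fixedBy (Fin 5) σ) : ℂ) - 1) = chi4 := by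
    funext σ; rw [chi4, natCard_fixedBy_eq_fixN]
  rwa [he] at h

/-- `χ₄(1) = 4`. [cite: JamesLiebeck2001, Example 20.14] -/
theorem chi4_one : chi4 1 = ((4 : ℕ) : ℂ) := by
  have : fixN 1 = 5 := by decide
  rw [chi4, this]; norm_num

/-- A scalar product of integer-valued-type functions, reduced to an integer sum. [folklore] -/
private theorem classInner_eq_of_sum (φ ψ : Alt5 → ℂ) (F : Alt5 → ℤ) (k : ℤ)
    (hF : ∀ g, φ g * ψ g⁻¹ * 100 = (F g : ℂ)) (hsum : ∑ g : Alt5, F g = 60 * k) :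
    classInner φ ψ = (k : ℂ) / 100 := by
  rw [classInner_apply, card_G]
  have h : ∑ g : Alt5, φ g * ψ g⁻¹ = ((∑ g : Alt5, F g : ℤ) : ℂ) / 100 := by
    rw [Int.cast_sum, Finset.sum_div]
    refine Finset.sum_congr rfl fun g _ => ?_
    rw [← hF g]; ring
  rw [h, hsum]
  push_cast
  ring

/-- `⟨M₂, 1⟩ = 1`. [cite: JamesLiebeck2001, Example 20.14] -/
private theorem classInner_M2_one :
    classInner (fun s : Alt5 => ((T2 s : ℕ) : ℂ) / 10) 1 = 1 := by
  rw [classInner_eq_of_sum _ _ (fun g => 10 * (T2 g : ℤ)) 100 (fun g => by simp; ring)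
    (by rw [← Finset.mul_sum, sum_M2_one]; norm_num)]
  norm_num

/-- `⟨M₂, M₂⟩ = 2`. [cite: JamesLiebeck2001, Example 20.14] -/
private theorem classInner_M2_M2 :
    classInner (fun s : Alt5 => ((T2 s : ℕ) : ℂ) / 10) (fun s : Alt5 => ((T2 s : ℕ) : ℂ) / 10) = 2 := by
  rw [classInner_eq_of_sum _ _ (fun g => (T2 g : ℤ) * (T2 g⁻¹ : ℤ)) 200
    (fun g => by push_cast; ring) (by rw [sum_M2_M2]; norm_num)]
  norm_num

/-- **`χ₅ = Ind_D 1 − 1` is an irreducible character of `A₅`** (`⟨M₂, 1⟩ = 1`, `⟨M₂, M₂⟩ = 2`: the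
action on the six Sylow `5`-subgroups is 2-transitive). [cite: JamesLiebeck2001, Example 20.14] -/
theorem isIrrChar_chi5 : IsIrrChar Alt5 chi5 := by
  have hchar : IsCharacter Alt5 (fun s : Alt5 => ((T2 s : ℕ) : ℂ) / 10) := by
    rw [← indClassFun_D_one_eq]
    exact (isCharacter_coe_monoidHom' (1 : D →* ℂˣ)).indClassFun D
  obtain ⟨ψ, hψ, -, hπ⟩ :=
    exists_isIrrChar_eq_one_add_of_classInner hchar classInner_M2_one classInner_M2_M2
  have he : chi5 = ψ := by
    funext g
    have := congrFun hπ g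
    simp only [Pi.add_apply, Pi.one_apply] at this
    rw [chi5, this]; ring
  rwa [he]

/-- `χ₅(1) = 5`. [cite: JamesLiebeck2001, Example 20.14] -/
theorem chi5_one : chi5 1 = ((5 : ℕ) : ℂ) := by
  have : T2 1 = 60 := by decide
  rw [chi5, this]; norm_num

/-! #### The scalar products `⟨χ₄, Mᵢ⟩`, `⟨χ₅, Mᵢ⟩` -/

/-- `⟨χ₄, M₁⟩ = 1`. [cite: JamesLiebeck2001, Example 20.14] -/
private theorem classInner_chi4_M1 : classInner chi4 (fun s : Alt5 => ((fixN s : ℕ) : ℂ)) = 1 := by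
  rw [classInner_eq_of_sum _ _ (fun g => 100 * (((fixN g : ℤ) - 1) * (fixN g⁻¹ : ℤ))) 100
    (fun g => by rw [chi4]; push_cast; ring) (by rw [← Finset.mul_sum, sum_chi4_M1]; norm_num)]
  norm_num

/-- `⟨χ₄, M₂⟩ = 0`. [cite: JamesLiebeck2001, Example 20.14] -/
private theorem classInner_chi4_M2 : classInner chi4 (fun s : Alt5 => ((T2 s : ℕ) : ℂ) / 10) = 0 := by
  rw [classInner_eq_of_sum _ _ (fun g => 10 * (((fixN g : ℤ) - 1) * (T2 g⁻¹ : ℤ))) 0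
    (fun g => by rw [chi4]; push_cast; ring) (by rw [← Finset.mul_sum, sum_chi4_M2]; norm_num)]
  norm_num

/-- `⟨χ₄, M₃⟩ = 0`. [cite: JamesLiebeck2001, Example 20.14] -/
private theorem classInner_chi4_M3 : classInner chi4 (fun s : Alt5 => ((T3 s : ℤ) : ℂ) / 10) = 0 := by
  rw [classInner_eq_of_sum _ _ (fun g => 10 * (((fixN g : ℤ) - 1) * T3 g⁻¹)) 0
    (fun g => by rw [chi4]; push_cast; ring) (by rw [← Finset.mul_sum, sum_chi4_M3]; norm_num)]
  norm_num

/-- `⟨χ₅, M₁⟩ = 0`. [cite: JamesLiebeck2001, Example 20.14] -/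
private theorem classInner_chi5_M1 : classInner chi5 (fun s : Alt5 => ((fixN s : ℕ) : ℂ)) = 0 := by
  rw [classInner_eq_of_sum _ _ (fun g => 10 * (((T2 g : ℤ) - 10) * (fixN g⁻¹ : ℤ))) 0
    (fun g => by rw [chi5]; push_cast; ring) (by rw [← Finset.mul_sum, sum_chi5_M1]; norm_num)]
  norm_num

/-- `⟨χ₅, M₂⟩ = 1`. [cite: JamesLiebeck2001, Example 20.14] -/
private theorem classInner_chi5_M2 : classInner chi5 (fun s : Alt5 => ((T2 s : ℕ) : ℂ) / 10) = 1 := by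
  rw [classInner_eq_of_sum _ _ (fun g => ((T2 g : ℤ) - 10) * (T2 g⁻¹ : ℤ)) 100
    (fun g => by rw [chi5]; push_cast; ring) (by rw [sum_chi5_M2]; norm_num)]
  norm_num

/-- `⟨χ₅, M₃⟩ = 0`. [cite: JamesLiebeck2001, Example 20.14] -/
private theorem classInner_chi5_M3 : classInner chi5 (fun s : Alt5 => ((T3 s : ℤ) : ℂ) / 10) = 0 := by
  rw [classInner_eq_of_sum _ _ (fun g => ((T2 g : ℤ) - 10) * T3 g⁻¹) 0
    (fun g => by rw [chi5]; push_cast; ring) (by rw [sum_chi5_M3]; norm_num)]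
  norm_num

/-! #### The irreducible characters of `A₅` of degree `≥ 4` -/

/-- Every irreducible character of `A₅` has degree `≤ 3`, or is `χ₄`, or is `χ₅` (degree census
`1, 3, 3, 4, 5` and uniqueness in degrees `4`, `5`). [cite: JamesLiebeck2001, Example 20.14] -/
theorem degree_le_three_or_eq {ρ : Alt5 → ℂ} (hρ : IsIrrChar Alt5 ρ) :
    (∃ d : ℕ, ρ 1 = d ∧ d ≤ 3) ∨ ρ = chi4 ∨ ρ = chi5 := by
  obtain ⟨d, hd, hd1⟩ := hρ.exists_apply_one
  have hmem := AlternatingFive.charDegrees_subset hd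
  have hdeg := JamesLiebeck2001_ex2014_degrees
  -- degrees `2, 6, 7` do not occur
  have hne : ∀ k : ℕ, Nat.card {χ : Alt5 → ℂ // IsIrrChar Alt5 χ ∧ χ 1 = ((k : ℕ) : ℂ)} = 0 →
      ρ 1 ≠ ((k : ℕ) : ℂ) := by
    intro k hk hk1
    have hne : Nonempty {χ : Alt5 → ℂ // IsIrrChar Alt5 χ ∧ χ 1 = ((k : ℕ) : ℂ)} := ⟨⟨ρ, hρ, hk1⟩⟩
    have hfin : Finite {χ : Alt5 → ℂ // IsIrrChar Alt5 χ ∧ χ 1 = ((k : ℕ) : ℂ)} :=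
      ((irrChars_finite_holds Alt5).subset (fun χ hχ => hχ.1)).to_subtype
    have hpos : 0 < Nat.card {χ : Alt5 → ℂ // IsIrrChar Alt5 χ ∧ χ 1 = ((k : ℕ) : ℂ)} := Nat.card_pos
    omega
  simp only [List.mem_cons, List.mem_nil_iff, or_false] at hmem
  rcases hmem with rfl | rfl | rfl | rfl | rfl | rfl | rfl
  · exact Or.inl ⟨1, hd1, by norm_num⟩
  · exact absurd hd1 (hne 2 hdeg.2.1)
  · exact Or.inl ⟨3, hd1, le_rfl⟩
  · exact Or.inr (Or.inl (eq_of_natCard_degree_eq_one hdeg.2.2.2.1 hρ hd1 isIrrChar_chi4 chi4_one))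
  · exact Or.inr (Or.inr (eq_of_natCard_degree_eq_one hdeg.2.2.2.2.1 hρ hd1 isIrrChar_chi5 chi5_one))
  · exact absurd hd1 (hne 6 hdeg.2.2.2.2.2.1)
  · exact absurd hd1 (hne 7 hdeg.2.2.2.2.2.2)

/-! #### The degree formula `χ₁(1) = 4n₁ + 5n₂ + 3n₃ − 8a` -/

/-- For a class function `χ` on `A₅`:
`χ(1) = 4⟨χ, M₁⟩ + 5⟨χ, M₂⟩ + 3⟨χ, M₃⟩ − 8⟨χ, 1⟩` (the identity `Ind_1^Alt5 1 = 4M₁ + 5M₂ + 3M₃ − 8`).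
[cite: JamesLiebeck2001, Example 20.14] -/
theorem apply_one_eq_combination {χ : Alt5 → ℂ} (hχ : IsClassFun χ) :
    χ 1 = 4 * classInner χ (fun s : Alt5 => ((fixN s : ℕ) : ℂ)) +
      5 * classInner χ (fun s : Alt5 => ((T2 s : ℕ) : ℂ) / 10) +
      3 * classInner χ (fun s : Alt5 => ((T3 s : ℤ) : ℂ) / 10) - 8 * classInner χ 1 := by
  have hreg : indClassFun (⊥ : Subgroup Alt5) (fun h => ((1 : (⊥ : Subgroup Alt5) →* ℂˣ) h : ℂ)) =
      (4 : ℂ) • (fun s : Alt5 => ((fixN s : ℕ) : ℂ)) + (5 : ℂ) • (fun s : Alt5 => ((T2 s : ℕ) : ℂ) / 10) +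
        (3 : ℂ) • (fun s : Alt5 => ((T3 s : ℤ) : ℂ) / 10) - (8 : ℂ) • (1 : Alt5 → ℂ) := by
    funext s
    rw [indClassFun_bot_apply, card_G]
    simp only [Pi.add_apply, Pi.sub_apply, Pi.smul_apply, Pi.one_apply, smul_eq_mul]
    have h := reg_identity s
    have h' : ((if s = 1 then (600 : ℤ) else 0 : ℤ) : ℂ) =
        ((40 * (fixN s : ℤ) + 5 * (T2 s : ℤ) + 3 * T3 s - 80 : ℤ) : ℂ) := by rw [h]
    push_cast at h'
    split_ifs at h' ⊢ with hs
    · linear_combination h' / 10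
    · linear_combination h' / 10
  rw [← classInner_indClassFun_bot χ hχ, hreg, classInner_sub_right, classInner_add_right,
    classInner_add_right, classInner_smul_right, classInner_smul_right, classInner_smul_right,
    classInner_smul_right]

end A5

/-! ### `A₅` is almost monomial -/

open A5 in
/-- **Booker 2006, Proposition 2.3, second group, PROVED: `A₅` is almost monomial.**
[cite: Booker2006, §2 Proposition 2.3 p. 390] -/
theorem isAlmostMonomial_alternatingGroup_five : IsAlmostMonomial (alternatingGroup (Fin 5)) := by
  intro ρ hρ χ₁ hχ₁ χ₂ hχ₂ h₁ h₂ hsum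
  have hρ' : IsIrrChar Alt5 ρ := hρ
  have hcl : IsClassFun χ₁ := isClassFun_of_mem_virtChars hχ₁
  rcases degree_le_three_or_eq hρ' with ⟨d, hd, hd3⟩ | hρ4 | hρ5
  · exact eq_zero_or_eq_zero_of_split_of_apply_one_le_three hρ' hχ₁ hχ₂ h₁ h₂ hsum hd hd3
  all_goals
    -- the four scalar products `n₁, n₂, n₃ ∈ ℕ`, `a = 0`
    obtain ⟨n₁, k₁, m₁, hn₁, -, hm₁, hnm₁⟩ :=
      exists_nat_classInner_of_split hρ' hχ₁ hχ₂ h₁ h₂ hsum (stabilizer Alt5 (0 : Fin 5)) 1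
    obtain ⟨n₂, k₂, m₂, hn₂, -, hm₂, hnm₂⟩ :=
      exists_nat_classInner_of_split hρ' hχ₁ hχ₂ h₁ h₂ hsum A5.D 1
    obtain ⟨n₃, k₃, m₃, hn₃, -, hm₃, hnm₃⟩ :=
      exists_nat_classInner_of_split hρ' hχ₁ hχ₂ h₁ h₂ hsum A5.D A5.eps
    rw [indClassFun_stabilizer_one_eq] at hn₁ hm₁
    rw [indClassFun_D_one_eq] at hn₂ hm₂
    rw [indClassFun_D_eps_eq] at hn₃ hm₃
    have ha : classInner χ₁ (fun g => ((1 : Alt5 →* ℂˣ) g : ℂ)) = 0 := by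
      refine classInner_coe_monoidHom_eq_zero_of_split hρ' hχ₁ hχ₂ h₁ h₂ hsum 1 fun h => ?_
      have h1 := congrFun h 1
      first
        | rw [hρ4, chi4_one] at h1
        | rw [hρ5, chi5_one] at h1
      simp at h1
    have ha' : classInner χ₁ 1 = 0 := by
      have : (fun g => ((1 : Alt5 →* ℂˣ) g : ℂ)) = (1 : Alt5 → ℂ) := by funext g; simp
      rwa [this] at ha
    have hdeg := apply_one_eq_combination hcl
    rw [hn₁, hn₂, hn₃, ha'] at hdeg
    refine eq_zero_or_eq_zero_of_split_of_apply_one hχ₁ hχ₂ h₁ h₂ hsum ?_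
  · -- `ρ = χ₄`: `m₁ = 1`, `m₂ = 0`, `m₃ = 0`
    rw [hρ4, classInner_chi4_M1] at hm₁
    rw [hρ4, classInner_chi4_M2] at hm₂
    rw [hρ4, classInner_chi4_M3] at hm₃
    have e1 : m₁ = 1 := by exact_mod_cast hm₁.symm
    have e2 : m₂ = 0 := by exact_mod_cast hm₂.symm
    have e3 : m₃ = 0 := by exact_mod_cast hm₃.symm
    have hn2 : n₂ = 0 := by omega
    have hn3 : n₃ = 0 := by omega
    rw [hn2, hn3] at hdeg
    rw [hρ4, chi4_one, hdeg]
    rcases Nat.eq_zero_or_pos n₁ with h0 | hpos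
    · left; rw [h0]; norm_num
    · right
      have : n₁ = 1 := by omega
      rw [this]; norm_num
  · -- `ρ = χ₅`: `m₁ = 0`, `m₂ = 1`, `m₃ = 0`
    rw [hρ5, classInner_chi5_M1] at hm₁
    rw [hρ5, classInner_chi5_M2] at hm₂
    rw [hρ5, classInner_chi5_M3] at hm₃
    have e1 : m₁ = 0 := by exact_mod_cast hm₁.symm
    have e2 : m₂ = 1 := by exact_mod_cast hm₂.symm
    have e3 : m₃ = 0 := by exact_mod_cast hm₃.symm
    have hn1 : n₁ = 0 := by omega
    have hn3 : n₃ = 0 := by omega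
    rw [hn1, hn3] at hdeg
    rw [hρ5, chi5_one, hdeg]
    rcases Nat.eq_zero_or_pos n₂ with h0 | hpos
    · left; rw [h0]; norm_num
    · right
      have : n₂ = 1 := by omega
      rw [this]; norm_num

end Booker2006

end Literature.NumberTheory.LFunctions

end
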